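import Mathlib
import Summits.Langlands.Langlands.Theses.PhantomRMYoshida
import Summits.Langlands.Langlands.Theorems.PhantomRMYoshidaStableYoshidaCongruenceSector
import HarnessLib

/-!
# Sketch — crux-ideate round 2, seat 5, crux `StableYoshidaCongruence` (stmt-Langlands-13640)

First lemmas of the two idea cards, typed over existing declarations (they need not be proved;
they must elaborate).

* `RegularStableYoshidaCongruence` — card `definite-quinary-escalator`: the ℓ₀ = 0 shadow of the
  crux.  For an eligible ordinary `p`-distinguished Yoshida pair possessing a CROSS-ONLY Chebotarev
  element, there is a REGULAR scalar weight `κ ≡ 2 (mod p-1)`, `κ ≥ 3`, and an irreducible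
  automorphic symplectic-`ε^{3-2κ}` Galois representation, Greenberg-ordinary of the regular shape
  `(0, κ-2, κ-1, 2κ-3)` at `p`, with residual pair `(σ, σ')`.  (The stable cohomological-weight point
  through the Yoshida maximal ideal; its weight-(2,2) descendant along the Borel-ordinary family is the
  card's "weak stable point".)
* `SemistableSectorAt3` — card `semistable-three-adic-anchor`: the Burkhardt–Weddle sector theorem
  with its 3-adic clause (`IsPeuRamifie`) DELETED: `p = 3`, `𝔽₃`-rational product of Frobenius
  polynomials, unramified at `2` off `4C/12C` ⇒ `CruxAt 3`.
-/

set_option linter.dupNamespace false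

noncomputable section

open IsDedekindDomain Polynomial
open scoped NumberField
open Literature.NumberTheory.GaloisRepresentations Literature.NumberTheory.Automorphic
open Summit.Langlands.Langlands.Theses.PhantomRMYoshida
open Summit.Langlands.Langlands.Cruxes.StableYoshidaCongruence.LevelThreeWeierstrassSwitch

namespace Summit.Langlands.Langlands.Cruxes.StableYoshidaCongruence.Round2Seat5

variable {p : ℕ} [Fact p.Prime] {k : Type} [Field k] [CharP k p] [TopologicalSpace k]
  [DiscreteTopology k]

variable (p) in
/-- A CROSS-ONLY Chebotarev element for the pair: `g ∈ Γ_ℚ` on which `σ`, `σ'` have split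
characteristic polynomials `(X-a)(X-b)`, `(X-c)(X-d)` with ONE cross ratio `c = ε̄(g)·a` and NO
internal Ribet ratio (`a ≠ ε̄(g) b`, `b ≠ ε̄(g) a`, `c ≠ ε̄(g) d`, `d ≠ ε̄(g) c`).  By Chebotarev on the
finite image of `σ × σ' × ε̄` it yields cross-only level-raising places (landed
`…CrossPlaceOfCrossElement`, p123368); it fails to exist only for projective images of order `≤ 10`
(Disproof §5 R7). -/
def HasCrossElement (σ σ' : FramedGaloisRep ℚ k 2) : Prop :=
  ∃ (g : Field.absoluteGaloisGroup ℚ) (a b c d : k),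
    FramedRep.charpoly σ g = (X - C a) * (X - C b) ∧
    FramedRep.charpoly σ' g = (X - C c) * (X - C d) ∧
    c = ((Units.map (ZMod.castHom (dvd_refl p) k).toMonoidHom (epsBar p g) : kˣ) : k) * a ∧
    a ≠ ((Units.map (ZMod.castHom (dvd_refl p) k).toMonoidHom (epsBar p g) : kˣ) : k) * b ∧
    b ≠ ((Units.map (ZMod.castHom (dvd_refl p) k).toMonoidHom (epsBar p g) : kˣ) : k) * a ∧
    c ≠ ((Units.map (ZMod.castHom (dvd_refl p) k).toMonoidHom (epsBar p g) : kˣ) : k) * d ∧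
    d ≠ ((Units.map (ZMod.castHom (dvd_refl p) k).toMonoidHom (epsBar p g) : kˣ) : k) * c

/-- `ShReg κ red σ σ' r`: the REGULAR-weight shape — symplectic with multiplier `ε^{-(2κ-3)}`,
Greenberg-ordinary of shape `(0, κ-2, κ-1, 2κ-3)` at `p` (for strictly increasing shapes this is the
literature's crystalline-ordinary notion, `isGreenbergOrdinaryOfShape_iff_of_injective`), residual
pair `(σ, σ')` through `red` (same a.e. clause as the crux's `Sh`). -/
def ShReg (κ : ℕ) (red : Valued.integer (PadicAlgCl p) →+* k) (σ σ' : FramedGaloisRep ℚ k 2)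
    (r : FramedGaloisRep ℚ (PadicAlgCl p) 4) : Prop :=
  r.IsSymplecticWithMultiplierFun (fun g => (invCyc p g) ^ (2 * κ - 3)) ∧
  (∀ v : HeightOneSpectrum (𝓞 ℚ), ((p : ℕ) : 𝓞 ℚ) ∈ v.asIdeal →
      r.IsGreenbergOrdinaryOfShapeAt v ![0, κ - 2, κ - 1, 2 * κ - 3]) ∧
  (∀ᶠ v : HeightOneSpectrum (𝓞 ℚ) in Filter.cofinite,
      r.IsUnramifiedAt v ∧ σ.IsUnramifiedAt v ∧ σ'.IsUnramifiedAt v ∧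
        ∃ (P : Polynomial (Valued.integer (PadicAlgCl p))) (P₁ P₂ : Polynomial k),
          r.HasFrobCharpolyAt v (P.map (Valued.integer (PadicAlgCl p)).subtype) ∧
            σ.HasFrobCharpolyAt v P₁ ∧ σ'.HasFrobCharpolyAt v P₂ ∧ P.map red = P₁ * P₂)

/-- **First lemma of card `definite-quinary-escalator`: the regular-weight (ℓ₀ = 0) stable Yoshida
congruence.**  Hypotheses = the crux's (`AutGL2`, irreducibility, `DetCond`, `NonConj`, H5) plus a
cross-only element; conclusion = an irreducible AUTOMORPHIC lift of REGULAR scalar weight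
`κ ≡ 2 (mod p-1)`, `κ ≥ 3`, with residual pair `(σ, σ')`.  Intended proof (paper): simultaneous GL₂ level
raising of the weight-2 ordinary lifts of `σ`, `σ'` at `q₀ ≡ -1 (p)` (common square-integrable place);
move `f` to weight `2 + 2(p-1)p^m` in its Hida family (residual pair unchanged); transfer the
cohomological Yoshida packet to the definite `GSpin₅ = GU₂(D_{q₀∞})` (Rösner–Weissauer); Ribet's
level-raising square at a cross-only place on the FINITE class set, whose one non-formal input is the
mod-`p` genericity (CHT-Ihara, rank 2) of the `𝔪`-part; transfer back, Galois representation
(Weissauer/Laumon), irreducibility (regular weight, general type). -/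
def RegularStableYoshidaCongruence : Prop :=
  ∀ (p : ℕ) [Fact p.Prime], p ≠ 2 → ∀ (k : Type) [Field k] [CharP k p] [IsAlgClosed k]
    [TopologicalSpace k] [DiscreteTopology k] (red : Valued.integer (PadicAlgCl p) →+* k)
    (σ σ' : FramedGaloisRep ℚ k 2),
    AutGL2 red σ → AutGL2 red σ' → σ.toGaloisRep.IsIrreducible → σ'.toGaloisRep.IsIrreducible →
    DetCond p σ σ' → NonConj σ σ' → (∃ ρ : FramedGaloisRep ℚ (PadicAlgCl p) 4, Sh red σ σ' ρ) →
    HasCrossElement p σ σ' →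
      ∀ (hcpt : isCompact_glFiniteIntegralLevel 4 ℚ) (ι : PadicAlgCl p ≃+* ℂ),
        ∃ (κ : ℕ) (ρ₁ : FramedGaloisRep ℚ (PadicAlgCl p) 4),
          3 ≤ κ ∧ (p - 1) ∣ (κ - 2) ∧
          ρ₁.toGaloisRep.IsIrreducible ∧ ShReg κ red σ σ' ρ₁ ∧ AutGL4 p hcpt ι ρ₁

/-- **First lemma of card `semistable-three-adic-anchor`: the `p = 3` sector WITHOUT a 3-adic
clause.**  Verbatim the landed `stub_bwSectorModuloFacts` sector predicate (p117182) with the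
`IsPeuRamifie` conjunct deleted; the crux's H5 already forces `σ|Γ₃`, `σ'|Γ₃` to be ordinary-shaped
(peu OR très ramifié), and a très ramifié block is anchored 3-adically by a Tate curve with
`3 ∤ v(q)` inside the rational twisted Burkhardt space `P(ρ̄)`; BCGP Thm 8.3.2 (2-adic, residually
`A₅(b)`) assumes nothing at `3`. -/
def SemistableSectorAt3 : Prop :=
  ∀ (p : ℕ) [Fact p.Prime], p ≠ 2 → ∀ (k : Type) [Field k] [CharP k p] [IsAlgClosed k]
    [TopologicalSpace k] [DiscreteTopology k] (red : Valued.integer (PadicAlgCl p) →+* k)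
    (σ σ' : FramedGaloisRep ℚ k 2),
    (p = 3 ∧
      (∀ g : Field.absoluteGaloisGroup ℚ, ∃ Q : Polynomial (ZMod p),
        Q.map (ZMod.castHom (dvd_refl p) k) = FramedRep.charpoly σ g * FramedRep.charpoly σ' g) ∧
      (∀ v : HeightOneSpectrum (𝓞 ℚ), ((2 : ℕ) : 𝓞 ℚ) ∈ v.asIdeal →
        σ.IsUnramifiedAt v ∧ σ'.IsUnramifiedAt v ∧
        ∃ P₁ P₂ : Polynomial k, σ.HasFrobCharpolyAt v P₁ ∧ σ'.HasFrobCharpolyAt v P₂ ∧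
          P₁ * P₂ ≠ (X ^ 2 + X + C 2) ^ 2 ∧ P₁ * P₂ ≠ (X ^ 2 - X + C 2) ^ 2)) →
    CruxAt p k red σ σ'

/-- Sanity: the semistable sector contains the landed Burkhardt–Weddle sector (drop the peu ramifié
clause), so the new statement is at least as strong as what p117182 proves modulo facts. -/
theorem semistableSectorAt3_imp_bwSector (h : SemistableSectorAt3) :
    ∀ (p : ℕ) [Fact p.Prime], p ≠ 2 → ∀ (k : Type) [Field k] [CharP k p] [IsAlgClosed k]
      [TopologicalSpace k] [DiscreteTopology k] (red : Valued.integer (PadicAlgCl p) →+* k)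
      (σ σ' : FramedGaloisRep ℚ k 2),
      (p = 3 ∧
        (∀ g : Field.absoluteGaloisGroup ℚ, ∃ Q : Polynomial (ZMod p),
          Q.map (ZMod.castHom (dvd_refl p) k) = FramedRep.charpoly σ g * FramedRep.charpoly σ' g) ∧
        (∀ v : HeightOneSpectrum (𝓞 ℚ), ((p : ℕ) : 𝓞 ℚ) ∈ v.asIdeal →
          ModPGaloisRep.IsPeuRamifie (σ.toLocal v) ∧ ModPGaloisRep.IsPeuRamifie (σ'.toLocal v)) ∧
        (∀ v : HeightOneSpectrum (𝓞 ℚ), ((2 : ℕ) : 𝓞 ℚ) ∈ v.asIdeal →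
          σ.IsUnramifiedAt v ∧ σ'.IsUnramifiedAt v ∧
          ∃ P₁ P₂ : Polynomial k, σ.HasFrobCharpolyAt v P₁ ∧ σ'.HasFrobCharpolyAt v P₂ ∧
            P₁ * P₂ ≠ (X ^ 2 + X + C 2) ^ 2 ∧ P₁ * P₂ ≠ (X ^ 2 - X + C 2) ^ 2)) →
      CruxAt p k red σ σ' :=
  fun p _ hp k _ _ _ _ _ red σ σ' ⟨hp3, hrat, _, htwo⟩ => h p hp k red σ σ' ⟨hp3, hrat, htwo⟩

/-- Sanity: the regular-weight statement's conclusion is NOT the crux's (different shape and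
multiplier), so it is not a restatement; but both share the hypothesis block, and the crux implies
nothing about it nor conversely without the wall descent. (Trivial typing check only.) -/
example : RegularStableYoshidaCongruence → RegularStableYoshidaCongruence := id

end Summit.Langlands.Langlands.Cruxes.StableYoshidaCongruence.Round2Seat5

end
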